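/-
Copyright (c) 2026. All rights reserved.
Released under Apache 2.0 license as described in the file LICENSE.
Authors: abc-iut cell, prover seat abc-iut-f-045 (gen 7).
-/
import Literature.IUT.LogVolume.LocalDegreeBridge
import Literature.IUT.LogVolume.RescaledCompletionInvariants
import Literature.NumberTheory.NumberFields.GaloisClosureDiscriminant
import Mathlib.NumberTheory.NumberField.Discriminant.Different
import Mathlib.NumberTheory.Cyclotomic.PrimitiveRoots
import HarnessLib

/-!
# The relative different of `F(ζ₃)/F`: coprime to every prime off `3`, trivial over the places with `e(v|3) = 2`,
# and `2·ord_Q 𝔇 ≤ e(Q|v)` over the unramified places above `3`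

Classical algebraic number theory (no definition, no `Prop` fact, no instance).  For number fields `F ⊆ E = F(ζ)`, `ζ` a
primitive cube root of unity with `X² + X + 1` irreducible over `F`, `𝔇 = 𝔇(𝓞_E/𝓞_F)` is Mathlib's `differentIdeal (𝓞 F) (𝓞 E)`.
* `two_mul_zeta_add_one_mem_differentIdeal`: `2ζ + 1 ∈ 𝔇` (Mathlib `aeval_derivative_mem_differentIdeal`, minimal polynomial
  `X² + X + 1`), with `(2ζ + 1)² = −3`; hence `emultiplicity_differentIdeal_eq_zero_of_three_not_mem`: `Q ∤ 𝔇` if `3 ∉ Q`;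
* `two_mul_emultiplicity_differentIdeal_le`: at `Q ∋ 3` over an UNRAMIFIED prime `q` of `𝓞_F`, `2·ord_Q 𝔇 ≤ ord_Q(q𝓞_E) = e(Q|q)`
  (`2·ord_Q(2ζ+1) = ord_Q(3) = e(Q|ℤ) = e(q|3)·e(Q|q)`, Mathlib `Ideal.ramificationIdx_tower`);
* `exists_sq_eq_three_mul`: at `q ∋ 3` with `e(q|3) = 2` there are `t, c ∈ 𝓞_F`, `t ≠ 0`, `t² = 3c`, `c ∉ q` (Dedekind CRT,
  and `Ideal.dvd_of_forall_emultiplicity_le` of `GaloisClosureDiscriminant.lean`);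
* `emultiplicity_differentIdeal_eq_zero_of_ramificationIdx_eq_two`: hence `Q ∤ 𝔇` for `Q` over such a `q` — `β := t(2ζ+1)/3`
  has `β² = −c`, lies in `𝓞_E`, generates `E/F` with minimal polynomial `X² + c`, so `2β ∈ 𝔇` while `2β ∉ Q`.

Consumer: `AdjoinCubeRootOfUnityDiscriminant.lean` (`|d_{F(ζ₃)}| ≤ 3^{Σ_{v ∣ 3, e(v|3)=1} f(v|3)} · d_F²`, the degree-doubling cut of
the abc-iut cell's R-J row Y-26).  Nothing here is specific to that consumer.
[cite: NeukirchANT1999, Ch. III §2, Prop. (2.4), Thm. (2.6)] [cite: SerreLocalFields1979, Ch. III §6 Prop. 13]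
-/

noncomputable section

open NumberField Polynomial IsDedekindDomain Module
namespace Literature.IUT.LogVolume

namespace AdjoinCubeRoot

open Literature.NumberTheory.NumberFields

variable {F E : Type} [Field F] [NumberField F] [Field E] [NumberField E] [Algebra F E]

/-! ## 1. Generalities on the relative different `𝔇(𝓞_E/𝓞_F)` -/

/-- If an integral generator `x` of `E/F` has `f'(x) = y` for its minimal polynomial `f` over `F`, then
`y ∈ 𝔇(𝓞_E/𝓞_F)` (Mathlib's `aeval_derivative_mem_differentIdeal`, read in `E`). [folklore] -/
private theorem mem_differentIdeal_of_aeval_derivative_minpoly_eq (x y : 𝓞 E) (hx : Algebra.adjoin F {(x : E)} = ⊤)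
    (hy : aeval (x : E) (derivative (minpoly F (x : E))) = (y : E)) :
    y ∈ differentIdeal (𝓞 F) (𝓞 E) := by
  have hmem := aeval_derivative_mem_differentIdeal (𝓞 F) F E x hx
  have hint : IsIntegral (𝓞 F) x := IsIntegralClosure.isIntegral (𝓞 F) E x
  have heq : aeval x (derivative (minpoly (𝓞 F) x)) = y := by
    apply RingOfIntegers.coe_injective
    change algebraMap (𝓞 E) E (aeval x (derivative (minpoly (𝓞 F) x))) = (y : E)
    rw [← hy]
    change _ = aeval (algebraMap (𝓞 E) E x) (derivative (minpoly F (algebraMap (𝓞 E) E x)))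
    rw [minpoly.isIntegrallyClosed_eq_field_fractions F E hint, derivative_map, aeval_map_algebraMap,
      aeval_algebraMap_apply]
  rwa [heq] at hmem

omit [NumberField F] in
/-- An element `y ∈ 𝔇(𝓞_E/𝓞_F)` outside a prime `Q` shows `Q ∤ 𝔇`, i.e. `𝔇` has multiplicity `0` at `Q`. [folklore] -/
private theorem emultiplicity_differentIdeal_eq_zero_of_mem_of_not_mem {Q : Ideal (𝓞 E)} {y : 𝓞 E}
    (hy : y ∈ differentIdeal (𝓞 F) (𝓞 E)) (hyQ : y ∉ Q) :
    emultiplicity Q (differentIdeal (𝓞 F) (𝓞 E)) = 0 := by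
  rw [emultiplicity_eq_zero]
  intro hdvd
  exact hyQ (Ideal.le_of_dvd hdvd hy)


/-- **`e(Q|ℤ)` as a multiplicity**: for a non-zero prime `Q` of `𝓞_E` containing the rational prime `p`,
`emultiplicity Q (p𝓞_E) = e(Q|p)`. [cite: NeukirchANT1999, Ch. I §8] -/
theorem emultiplicity_span_natCast_eq_ramificationIdx {K : Type} [Field K] [NumberField K] (p : ℕ) [hp : Fact p.Prime]
    (Q : Ideal (𝓞 K)) [Q.IsMaximal] (hQ0 : Q ≠ ⊥) (hpQ : ((p : ℕ) : 𝓞 K) ∈ Q) :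
    emultiplicity Q (Ideal.span {((p : ℕ) : 𝓞 K)}) = Q.ramificationIdx ℤ := by
  haveI : Q.LiesOver (Ideal.span {(p : ℤ)}) :=
    liesOver_span_of_natCast_mem K p ⟨Q, Ideal.IsMaximal.isPrime inferInstance, hQ0⟩ hpQ
  have hmap : (Ideal.span {(p : ℤ)}).map (algebraMap ℤ (𝓞 K)) = Ideal.span {((p : ℕ) : 𝓞 K)} := by
    rw [Ideal.map_span, Set.image_singleton, map_natCast]
  have hne : (Ideal.span {(p : ℤ)}).map (algebraMap ℤ (𝓞 K)) ≠ ⊥ := by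
    rw [hmap, Ne, Ideal.span_singleton_eq_bot]; exact_mod_cast hp.out.ne_zero
  have hprime : Prime Q := Ideal.prime_of_isPrime hQ0 inferInstance
  have hne' : Ideal.span {((p : ℕ) : 𝓞 K)} ≠ ⊥ := hmap ▸ hne
  rw [Ideal.IsDedekindDomain.ramificationIdx_eq_multiplicity (Ideal.span {(p : ℤ)}) Q hne, hmap,
    (FiniteMultiplicity.of_prime_left hprime hne').emultiplicity_eq_multiplicity]

omit [NumberField F] in
/-- **`e(Q|q)` as a multiplicity**: for a non-zero prime `Q` of `𝓞_E` over the prime `q = Q ∩ 𝓞_F`,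
`emultiplicity Q (q𝓞_E) = e(Q|q)`. [cite: NeukirchANT1999, Ch. I §8] -/
theorem emultiplicity_map_under_eq_ramificationIdx (Q : Ideal (𝓞 E)) [Q.IsMaximal] (hQ0 : Q ≠ ⊥) :
    emultiplicity Q ((Q.under (𝓞 F)).map (algebraMap (𝓞 F) (𝓞 E))) = Q.ramificationIdx (𝓞 F) := by
  have hq0 : Q.under (𝓞 F) ≠ ⊥ := fun h => hQ0 (Ideal.eq_bot_of_comap_eq_bot h)
  have hne : (Q.under (𝓞 F)).map (algebraMap (𝓞 F) (𝓞 E)) ≠ ⊥ := Ideal.map_ne_bot_of_ne_bot hq0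
  have hprime : Prime Q := Ideal.prime_of_isPrime hQ0 inferInstance
  rw [Ideal.IsDedekindDomain.ramificationIdx_eq_multiplicity (Q.under (𝓞 F)) Q hne,
    (FiniteMultiplicity.of_prime_left hprime hne).emultiplicity_eq_multiplicity]

/-- **The element `t` at a `(2,·)`-place `q` of `F` over `3`**: if `e(q|3) = 2` there are `t, c ∈ 𝓞_F` with `t ≠ 0`,
`t² = 3c` and `c ∉ q` (Dedekind CRT: `ord_q t = 1` and `ord_w t ≥ e(w|3)` at the other places `w ∣ 3`, so that `3 ∣ t²`
with `ord_q(t²/3) = 0`). [cite: NeukirchANT1999, Ch. I §3, Thm. (3.6)] -/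
theorem exists_sq_eq_three_mul (q : Ideal (𝓞 F)) [hqm : q.IsMaximal] (hq0 : q ≠ ⊥) (h3 : ((3 : ℕ) : 𝓞 F) ∈ q)
    (he : q.ramificationIdx ℤ = 2) : ∃ t c : 𝓞 F, t ≠ 0 ∧ t ^ 2 = 3 * c ∧ c ∉ q := by
  classical
  haveI : Fact (Nat.Prime 3) := ⟨Nat.prime_three⟩
  have hqprime : Prime q := Ideal.prime_of_isPrime hq0 inferInstance
  let v₀ : HeightOneSpectrum (𝓞 F) := ⟨q, Ideal.IsMaximal.isPrime hqm, hq0⟩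
  have hv₀ : v₀ ∈ placesOver F 3 := (mem_placesOver_iff v₀).mpr (liesOver_span_of_natCast_mem F 3 v₀ h3)
  -- `π ∈ q ∖ q²`
  obtain ⟨π, hπq, hπq2⟩ := SetLike.exists_of_lt
    (show q ^ 2 < q by simpa using Ideal.pow_right_strictAnti q hq0 hqm.ne_top (by norm_num : 1 < 2))
  -- Chinese remainder: `t ≡ π mod q²`, `t ≡ 0 mod w^{e(w|3)}` for the other `w ∣ 3`
  obtain ⟨t, ht⟩ := IsDedekindDomain.exists_forall_sub_mem_ideal (s := placesOver F 3)
    (fun w : HeightOneSpectrum (𝓞 F) => w.asIdeal)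
    (fun w => if w = v₀ then 2 else w.asIdeal.ramificationIdx ℤ) (fun w _ => w.prime)
    (fun w _ w' _ hne h => hne (HeightOneSpectrum.ext h))
    (fun w => if (w : HeightOneSpectrum (𝓞 F)) = v₀ then π else 0)
  have htq2 : t - π ∈ q ^ 2 := by simpa using ht v₀ hv₀
  have htw : ∀ w ∈ placesOver F 3, w ≠ v₀ → t ∈ w.asIdeal ^ w.asIdeal.ramificationIdx ℤ := by
    intro w hw hne
    simpa [hne] using ht w hw
  have htq : t ∈ q := by simpa using q.add_mem (Ideal.pow_le_self two_ne_zero htq2) hπq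
  have htq2' : t ∉ q ^ 2 := fun h => hπq2 (by simpa using (q ^ 2).sub_mem h htq2)
  have ht0 : t ≠ 0 := fun h => htq2' (h ▸ (q ^ 2).zero_mem)
  -- multiplicities of `span {t}`
  have hmq : (1 : ℕ∞) ≤ emultiplicity q (Ideal.span {t}) :=
    le_emultiplicity_of_pow_dvd (by rw [pow_one, Ideal.dvd_span_singleton]; exact htq)
  have hmq' : emultiplicity q (Ideal.span {t}) < 2 := by
    by_contra hge
    push Not at hge
    have hdvd : q ^ 2 ∣ Ideal.span {t} := pow_dvd_of_le_emultiplicity hge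
    exact htq2' (Ideal.dvd_span_singleton.mp hdvd)
  have he3 : emultiplicity q (Ideal.span {((3 : ℕ) : 𝓞 F)}) = 2 := by
    rw [emultiplicity_span_natCast_eq_ramificationIdx (K := F) 3 q hq0 h3, he]; rfl
  -- `3 ∣ t²`
  have h3ne : Ideal.span {((3 : ℕ) : 𝓞 F)} ≠ ⊥ := by
    rw [Ne, Ideal.span_singleton_eq_bot]; exact_mod_cast (by norm_num : (3 : ℕ) ≠ 0)
  have ht2ne : Ideal.span {t ^ 2} ≠ ⊥ := by rw [Ne, Ideal.span_singleton_eq_bot]; exact pow_ne_zero 2 ht0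
  have hdvd : Ideal.span {((3 : ℕ) : 𝓞 F)} ∣ Ideal.span {t ^ 2} := by
    refine Ideal.dvd_of_forall_emultiplicity_le h3ne ht2ne fun P hPmax hP0 => ?_
    have hPprime : Prime P := Ideal.prime_of_isPrime hP0 hPmax.isPrime
    rw [← Ideal.span_singleton_pow, emultiplicity_pow hPprime]
    by_cases hP3 : ((3 : ℕ) : 𝓞 F) ∈ P
    · haveI := hPmax
      rw [emultiplicity_span_natCast_eq_ramificationIdx (K := F) 3 P hP0 hP3]
      let w : HeightOneSpectrum (𝓞 F) := ⟨P, hPmax.isPrime, hP0⟩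
      have hw : w ∈ placesOver F 3 := (mem_placesOver_iff w).mpr (liesOver_span_of_natCast_mem F 3 w hP3)
      by_cases hwv : w = v₀
      · have hPq : P = q := congrArg HeightOneSpectrum.asIdeal hwv
        subst hPq
        rw [he]
        calc ((2 : ℕ) : ℕ∞) = 2 * 1 := by norm_num
          _ ≤ (2 : ℕ) * emultiplicity P (Ideal.span {t}) := by push_cast; gcongr
      · have hle : (w.asIdeal.ramificationIdx ℤ : ℕ∞) ≤ emultiplicity P (Ideal.span {t}) :=
          le_emultiplicity_of_pow_dvd (by rw [Ideal.dvd_span_singleton]; exact htw w hw hwv)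
        calc (P.ramificationIdx ℤ : ℕ∞) ≤ emultiplicity P (Ideal.span {t}) := hle
          _ ≤ (2 : ℕ) * emultiplicity P (Ideal.span {t}) := le_mul_of_one_le_left zero_le (by norm_num)
    · rw [emultiplicity_eq_zero.mpr (by rwa [Ideal.dvd_span_singleton]), ]
      exact zero_le
  obtain ⟨c, hc⟩ := Ideal.mem_span_singleton'.mp (Ideal.dvd_span_singleton.mp hdvd)
  refine ⟨t, c, ht0, by rw [← hc, mul_comm]; push_cast; ring, fun hcq => ?_⟩
  -- `c ∈ q` would force `ord_q(t²) ≥ 3`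
  have hc1 : (1 : ℕ∞) ≤ emultiplicity q (Ideal.span {c}) :=
    le_emultiplicity_of_pow_dvd (by rw [pow_one, Ideal.dvd_span_singleton]; exact hcq)
  have ht2 : emultiplicity q (Ideal.span {t ^ 2}) = (2 : ℕ) * emultiplicity q (Ideal.span {t}) := by
    rw [← Ideal.span_singleton_pow, emultiplicity_pow hqprime]
  have ht2' : emultiplicity q (Ideal.span {t ^ 2}) =
      emultiplicity q (Ideal.span {((3 : ℕ) : 𝓞 F)}) + emultiplicity q (Ideal.span {c}) := by
    rw [← emultiplicity_mul hqprime, Ideal.span_singleton_mul_span_singleton, ← hc, mul_comm]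
  rw [(FiniteMultiplicity.of_prime_left hqprime (by rw [Ne, Ideal.zero_eq_bot, Ideal.span_singleton_eq_bot]; exact ht0) :
    FiniteMultiplicity q (Ideal.span {t})).emultiplicity_eq_multiplicity] at hmq' ht2
  have hfinc : FiniteMultiplicity q (Ideal.span {c}) :=
    FiniteMultiplicity.of_prime_left hqprime (by
      rw [Ne, Ideal.zero_eq_bot, Ideal.span_singleton_eq_bot]
      rintro rfl
      apply ht0
      have : t ^ 2 = 0 := by rw [← hc]; simp
      exact pow_eq_zero_iff (n := 2) (by norm_num) |>.mp this)
  rw [hfinc.emultiplicity_eq_multiplicity] at hc1 ht2'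
  rw [ht2, he3] at ht2'
  have h1 : multiplicity q (Ideal.span {t}) < 2 := by exact_mod_cast hmq'
  have h2 : 1 ≤ multiplicity q (Ideal.span {c}) := by exact_mod_cast hc1
  have h4 : 2 * multiplicity q (Ideal.span {t}) = 2 + multiplicity q (Ideal.span {c}) := by
    exact_mod_cast (show ((2 * multiplicity q (Ideal.span {t}) : ℕ) : ℕ∞) = ((2 + multiplicity q (Ideal.span {c}) : ℕ) : ℕ∞)
      by push_cast; exact ht2')
  omega

/-! ## 2. The relative different of `F(ζ₃)/F` -/

section CubeRoot

variable (ζ : 𝓞 E) (hζ : IsPrimitiveRoot (ζ : E) 3) (hirr : Irreducible (cyclotomic 3 F))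
  (hgen : Algebra.adjoin F {(ζ : E)} = ⊤)

omit [NumberField F] [NumberField E] in
include hζ in
/-- `ζ² + ζ + 1 = 0` for a primitive cube root of unity. [folklore] -/
private theorem zeta_sq_add : (ζ : E) ^ 2 + ζ + 1 = 0 := by
  have h := hζ.isRoot_cyclotomic (by norm_num)
  rwa [cyclotomic_three, IsRoot.def, eval_add, eval_add, eval_pow, eval_X, eval_one] at h

omit [NumberField F] [NumberField E] in
include hζ in
/-- `(2ζ + 1)² = −3`: the quadratic Gauss sum `g = ζ − ζ² = 2ζ + 1` at `p = 3` has `g² = (−1)^{(p−1)/2} p = −3`.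
[cite: IrelandRosen1990, Ch. 6 §3, Prop. 6.3.2] -/
theorem two_mul_zeta_add_one_sq : (2 * ζ + 1) ^ 2 = -3 := by
  apply RingOfIntegers.coe_injective
  have h := zeta_sq_add ζ hζ
  change algebraMap (𝓞 E) E ((2 * ζ + 1) ^ 2) = algebraMap (𝓞 E) E (-3)
  simp only [map_pow, map_add, map_mul, map_ofNat, map_one, map_neg]
  change ((2 : E) * (ζ : E) + 1) ^ 2 = -3
  linear_combination (4 : E) * h

omit [NumberField F] [NumberField E] in
include hζ hirr in
/-- `ζ ∉ F` when `X² + X + 1` is irreducible over `F`. [folklore] -/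
private theorem zeta_not_mem_range : (ζ : E) ∉ Set.range (algebraMap F E) := by
  rintro ⟨r, hr⟩
  have hroot : IsRoot (cyclotomic 3 F) r := by
    have h := hζ.isRoot_cyclotomic (by norm_num)
    rw [← map_cyclotomic 3 (algebraMap F E), IsRoot.def, eval_map, ← aeval_def, ← hr, aeval_algebraMap_apply,
      map_eq_zero_iff _ (algebraMap F E).injective] at h
    exact h
  have h1 := degree_eq_one_of_irreducible_of_root hirr hroot
  rw [degree_cyclotomic, Nat.totient_prime Nat.prime_three] at h1
  norm_num at h1

include hζ hirr hgen in
/-- **`2ζ + 1 ∈ 𝔇(𝓞_E/𝓞_F)`**: the derivative of the minimal polynomial `X² + X + 1` of the integral generator `ζ`.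
[cite: NeukirchANT1999, Ch. III §2, Lemma (2.2) and Prop. (2.4)] -/
theorem two_mul_zeta_add_one_mem_differentIdeal : 2 * ζ + 1 ∈ differentIdeal (𝓞 F) (𝓞 E) := by
  refine mem_differentIdeal_of_aeval_derivative_minpoly_eq ζ (2 * ζ + 1) hgen ?_
  haveI : NeZero ((3 : ℕ) : F) := NeZero.charZero
  rw [← hζ.minpoly_eq_cyclotomic_of_irreducible hirr, cyclotomic_three]
  simp only [map_add, derivative_X_pow, Nat.cast_ofNat, Nat.reduceSub, pow_one, derivative_X, derivative_one,
    map_mul, map_ofNat, aeval_X, map_one, add_zero]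

include hζ hirr hgen in
/-- **`𝔇(𝓞_E/𝓞_F)` is coprime to every prime not over `3`** (`(2ζ+1)² = −3`). [cite: NeukirchANT1999, Ch. III Thm. (2.6)] -/
theorem emultiplicity_differentIdeal_eq_zero_of_three_not_mem (Q : Ideal (𝓞 E)) [Q.IsPrime]
    (h3 : ((3 : ℕ) : 𝓞 E) ∉ Q) : emultiplicity Q (differentIdeal (𝓞 F) (𝓞 E)) = 0 := by
  refine emultiplicity_differentIdeal_eq_zero_of_mem_of_not_mem
    (two_mul_zeta_add_one_mem_differentIdeal ζ hζ hirr hgen) fun hmem => h3 ?_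
  have hsq : (2 * ζ + 1) ^ 2 ∈ Q := Q.pow_mem_of_mem hmem 2 (by norm_num)
  rw [two_mul_zeta_add_one_sq ζ hζ] at hsq
  have : (3 : 𝓞 E) ∈ Q := by simpa using Q.neg_mem_iff.mp hsq
  exact_mod_cast this

include hζ hirr hgen in
/-- **At a prime `Q` over an UNRAMIFIED place of `F` above `3`: `2·ord_Q 𝔇(𝓞_E/𝓞_F) ≤ e(Q|q) = ord_Q(q𝓞_E)`** —
`ord_Q 𝔇 ≤ ord_Q(2ζ+1)` and `2·ord_Q(2ζ+1) = ord_Q(3) = e(Q|ℤ) = e(q|3)·e(Q|q) = e(Q|q)`.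
[cite: NeukirchANT1999, Ch. III Thm. (2.6)] -/
theorem two_mul_emultiplicity_differentIdeal_le (Q : Ideal (𝓞 E)) [Q.IsMaximal] (hQ0 : Q ≠ ⊥)
    (h3 : ((3 : ℕ) : 𝓞 E) ∈ Q) (he : (Q.under (𝓞 F)).ramificationIdx ℤ = 1) :
    2 * emultiplicity Q (differentIdeal (𝓞 F) (𝓞 E)) ≤
      emultiplicity Q ((Q.under (𝓞 F)).map (algebraMap (𝓞 F) (𝓞 E))) := by
  haveI : Fact (Nat.Prime 3) := ⟨Nat.prime_three⟩
  have hprime : Prime Q := Ideal.prime_of_isPrime hQ0 inferInstance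
  have h1 : emultiplicity Q (differentIdeal (𝓞 F) (𝓞 E)) ≤ emultiplicity Q (Ideal.span {2 * ζ + 1}) :=
    emultiplicity_le_emultiplicity_of_dvd_right
      (Ideal.dvd_span_singleton.mpr (two_mul_zeta_add_one_mem_differentIdeal ζ hζ hirr hgen))
  have h2 : 2 * emultiplicity Q (Ideal.span {2 * ζ + 1}) = emultiplicity Q (Ideal.span {((3 : ℕ) : 𝓞 E)}) := by
    have h := emultiplicity_pow hprime (a := Ideal.span {2 * ζ + 1}) (k := 2)
    rw [Ideal.span_singleton_pow, two_mul_zeta_add_one_sq ζ hζ, Ideal.span_singleton_neg] at h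
    rw [Nat.cast_ofNat] at h ⊢
    exact h.symm
  have h3' := emultiplicity_span_natCast_eq_ramificationIdx (K := E) 3 Q hQ0 h3
  have htower := Ideal.ramificationIdx_tower (R := ℤ) (Q.under (𝓞 F)) Q
  rw [he, one_mul] at htower
  calc 2 * emultiplicity Q (differentIdeal (𝓞 F) (𝓞 E))
      ≤ 2 * emultiplicity Q (Ideal.span {2 * ζ + 1}) := by gcongr
    _ = (Q.ramificationIdx ℤ : ℕ∞) := by rw [h2, h3']
    _ = Q.ramificationIdx (𝓞 F) := by rw [htower]
    _ = _ := (emultiplicity_map_under_eq_ramificationIdx Q hQ0).symm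

include hζ hirr hgen in
/-- **At a prime `Q` over a RAMIFIED place `q` of `F` above `3` (`e(q|3) = 2`): `Q ∤ 𝔇(𝓞_E/𝓞_F)`.**  With `t, c` as in
`exists_sq_eq_three_mul` the element `β := t(2ζ+1)/3 ∈ E` has `β² = −c ∈ 𝓞_F`, so `β ∈ 𝓞_E`, `F(β) = F(ζ) = E`, its
minimal polynomial is `X² + c`, hence `2β ∈ 𝔇`; and `2β ∉ Q` because `2 ∉ Q ∋ 3` and `β² = −c ∉ q = Q ∩ 𝓞_F`.
[cite: NeukirchANT1999, Ch. III §2, Prop. (2.4) and Thm. (2.6)] -/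
theorem emultiplicity_differentIdeal_eq_zero_of_ramificationIdx_eq_two (Q : Ideal (𝓞 E)) [Q.IsMaximal] (hQ0 : Q ≠ ⊥)
    (h3 : ((3 : ℕ) : 𝓞 E) ∈ Q) (he : (Q.under (𝓞 F)).ramificationIdx ℤ = 2) :
    emultiplicity Q (differentIdeal (𝓞 F) (𝓞 E)) = 0 := by
  haveI : (Q.under (𝓞 F)).IsMaximal := Ideal.IsMaximal.under (𝓞 F) Q
  have hq0 : Q.under (𝓞 F) ≠ ⊥ := fun h => hQ0 (Ideal.eq_bot_of_comap_eq_bot h)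
  obtain ⟨t, c, ht0, htc, hcq⟩ := exists_sq_eq_three_mul (Q.under (𝓞 F)) hq0
    (by rw [Ideal.under_def, Ideal.mem_comap, map_natCast]; exact h3) he
  -- the element `β = t·(2ζ+1)/3`
  have hy2 : ((2 * ζ + 1 : 𝓞 E) : E) ^ 2 = -3 := by
    have h := congrArg (algebraMap (𝓞 E) E) (two_mul_zeta_add_one_sq ζ hζ)
    rw [map_pow, map_neg, map_ofNat] at h
    exact h
  have hycoe : ((2 * ζ + 1 : 𝓞 E) : E) = 2 * (ζ : E) + 1 := by
    change algebraMap (𝓞 E) E (2 * ζ + 1) = 2 * algebraMap (𝓞 E) E ζ + 1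
    rw [map_add, map_mul, map_ofNat, map_one]
  have htF : ((t : F)) ≠ 0 := fun h => ht0 (RingOfIntegers.coe_injective (by simpa using h))
  have htE : algebraMap F E (t : F) ≠ 0 := by simpa using htF
  have htcE : (algebraMap F E (t : F)) ^ 2 = 3 * algebraMap F E (c : F) := by
    have h := congrArg (algebraMap (𝓞 F) F) htc
    rw [map_pow, map_mul, map_ofNat] at h
    rw [← map_pow, ← map_ofNat (algebraMap F E) 3, ← map_mul]
    exact congrArg (algebraMap F E) h
  set β : E := algebraMap F E (t : F) * ((2 * ζ + 1 : 𝓞 E) : E) / 3 with hβdef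
  have hβ2 : β ^ 2 = algebraMap F E (((-c : 𝓞 F)) : F) := by
    rw [hβdef, div_pow, mul_pow, hy2, htcE]
    push_cast
    field_simp
  have hβint : IsIntegral ℤ β :=
    IsIntegral.of_pow two_pos (by rw [hβ2]; exact (RingOfIntegers.isIntegral_coe (-c)).algebraMap)
  set β' : 𝓞 E := ⟨β, hβint⟩ with hβ'def
  have hβ'E : ((β' : 𝓞 E) : E) = β := rfl
  -- `(2ζ+1) = (3/t)·β`, so `β` generates `E/F` and `β ∉ F`
  have hyβ : ((2 * ζ + 1 : 𝓞 E) : E) = algebraMap F E (3 / (t : F)) * β := by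
    rw [hβdef, map_div₀, map_ofNat]
    field_simp
  have hζβ : (ζ : E) = algebraMap F E (1 / 2) * (algebraMap F E (3 / (t : F)) * β - 1) := by
    rw [← hyβ, hycoe, map_div₀, map_one, map_ofNat]
    field_simp
    ring
  have hadj : Algebra.adjoin F {β} = ⊤ := by
    rw [eq_top_iff, ← hgen]
    refine Algebra.adjoin_le (Set.singleton_subset_iff.mpr ?_)
    rw [SetLike.mem_coe, hζβ]
    exact mul_mem (Subalgebra.algebraMap_mem _ _)
      (sub_mem (mul_mem (Subalgebra.algebraMap_mem _ _) (Algebra.subset_adjoin rfl)) (one_mem _))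
  have hβF : β ∉ (algebraMap F E).range := by
    rintro ⟨r, hr⟩
    refine zeta_not_mem_range ζ hζ hirr ⟨1 / 2 * (3 / (t : F) * r - 1), ?_⟩
    rw [hζβ, ← hr]
    simp only [map_mul, map_sub, map_one]
  -- minimal polynomial `X² + c`
  have hintF : IsIntegral F β := hβint.tower_top
  have hmin : minpoly F β = X ^ 2 + C ((c : 𝓞 F) : F) := by
    have hp : (X ^ 2 + C ((c : 𝓞 F) : F) : F[X]).Monic := monic_X_pow_add_C _ two_ne_zero
    have hroot : aeval β (X ^ 2 + C ((c : 𝓞 F) : F) : F[X]) = 0 := by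
      simp only [map_add, map_pow, aeval_X, aeval_C, hβ2]
      push_cast
      simp
    symm
    refine Polynomial.eq_of_monic_of_dvd_of_natDegree_le (minpoly.monic hintF) hp (minpoly.dvd F β hroot) ?_
    rw [natDegree_X_pow_add_C]
    have h1 : (minpoly F β).natDegree ≠ 1 := fun h => hβF ((minpoly.natDegree_eq_one_iff).mp h)
    have hpos := minpoly.natDegree_pos hintF
    omega
  -- `2β ∈ 𝔇`
  have hmem : 2 * β' ∈ differentIdeal (𝓞 F) (𝓞 E) := by
    refine mem_differentIdeal_of_aeval_derivative_minpoly_eq β' (2 * β') hadj ?_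
    rw [hβ'E, hmin]
    simp only [derivative_add, derivative_X_pow, Nat.cast_ofNat, Nat.reduceSub, pow_one, derivative_C, add_zero,
      map_mul, map_ofNat, aeval_X]
    rfl
  -- `2β ∉ Q`
  have h2Q : (2 : 𝓞 E) ∉ Q := fun h2 => Ideal.IsMaximal.ne_top ‹Q.IsMaximal› ((Ideal.eq_top_iff_one Q).mpr (by
    have h := Q.sub_mem h3 h2
    norm_num at h
    exact h))
  have hβQ : β' ∉ Q := by
    intro hβQ
    apply hcq
    have hsq : β' ^ 2 ∈ Q := Q.pow_mem_of_mem hβQ 2 two_pos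
    have hsq' : β' ^ 2 = algebraMap (𝓞 F) (𝓞 E) (-c) := by
      apply RingOfIntegers.coe_injective
      change ((β' : 𝓞 E) : E) ^ 2 = ((algebraMap (𝓞 F) (𝓞 E) (-c) : 𝓞 E) : E)
      rw [hβ'E, hβ2]
      change algebraMap F E (algebraMap (𝓞 F) F (-c)) = algebraMap (𝓞 E) E (algebraMap (𝓞 F) (𝓞 E) (-c))
      rw [← IsScalarTower.algebraMap_apply, ← IsScalarTower.algebraMap_apply]
    rw [hsq'] at hsq
    have : -c ∈ Q.under (𝓞 F) := by rw [Ideal.under_def, Ideal.mem_comap]; exact hsq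
    simpa using this
  exact emultiplicity_differentIdeal_eq_zero_of_mem_of_not_mem hmem fun h =>
    ((Ideal.IsMaximal.isPrime ‹Q.IsMaximal›).mem_or_mem h).elim h2Q hβQ

end CubeRoot

end AdjoinCubeRoot

end Literature.IUT.LogVolume
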